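import Literature.Combinatorics.StablePolynomials.MasterCompositionDisk
import Literature.Combinatorics.StablePolynomials.SzaszCoefficientBound
import HarnessLib

/-!
# The Schur–Hadamard product of `𝔻`-stable polynomials (Borcea–Brändén II, §8.2: Theorems 8.5 and 8.6)

J. Borcea, P. Brändén, *The Lee–Yang and Pólya–Schur programs. II.*, Comm. Pure Appl. Math. 62 (2009)
1595–1631 (arXiv:0809.3087), §8.2:

> … the Schur–Hadamard product of multi-affine polynomials … : if `f(z) = Σ_{S ⊆ [n]} a(S) z^S` and
> `g(z) = Σ_{S ⊆ [n]} b(S) z^S` then `(f • g)(z) = Σ_{S ⊆ [n]} a(S) b(S) z^S`.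
>
> **Theorem 8.5** (Hinkkanen's composition theorem). Let `f, g ∈ ℂ_{(1ⁿ)}[z_1,…,z_n]`. If `f, g` are `𝔻`-stable
> then so is `f • g` unless it is identically zero.
> *Proof.* … `T(f) = f • g` … The symbol of `T` is `T[(1+zw)^{[n]}] = g(z_1w_1,…,z_nw_n)`, which is clearly
> `𝔻`-stable (in `2n` variables). Theorem 3.2 yields the result.
>
> **Theorem 8.6.** Let `f(z) = Σ_{α≤κ} binom(κ,α) a(α) z^α` and `g(z) = Σ_{α≤κ} binom(κ,α) b(α) z^α` be
> `𝔻`-stable polynomials. Then so is `(f • g)(z) := Σ_{α≤κ} binom(κ,α) a(α) b(α) z^α` unless it is identically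
> zero. *Proof.* Apply Corollary 3.4 (c) to the `𝔻`-stable polynomials `f(z)` and `g(zw)`.

Here `f • g` for Theorem 8.5 is the coefficientwise product `schurHadamard f g` (the tree's diagonal operator
`mvMultiplierOp (coeff · g)` applied to `f`; on multi-affine polynomials it is the displayed `Σ a(S)b(S)z^S`), and
for Theorem 8.6 the binomially weighted polynomials are `binomWeighted κ a = Σ_{α≤κ} binom(κ,α) a(α) z^α`.

## Contents

* `schurHadamard`, `coeff_schurHadamard`, `schurHadamard_comm`.
* `mvMultiplierOp_coeff_prod_one_add`, `isDiskStable_boundedDegreeSymbolD_mvMultiplierOp` (the symbol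
  `T[(1+zw)^{[n]}] = g(zw)`), **`hinkkanen_schurHadamard`** (Theorem 8.5).
* `binomWeighted`, **`schurHadamard_binomWeighted_diskStable`** (Theorem 8.6).

## References

* [BorceaBranden2009II] J. Borcea, P. Brändén, Comm. Pure Appl. Math. 62 (2009) 1595–1631, §8.2 Thms 8.5, 8.6.
* A. Hinkkanen, *Schur products of certain polynomials*, Contemp. Math. 211 (1997) 285–295 (the reference
  [hink] of [BorceaBranden2009II]; Theorem 8.5 is attributed to it there).
-/

noncomputable section

open MvPolynomial Finset

namespace Literature.Combinatorics.StablePolynomials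

variable {τ : Type*} [Fintype τ] [DecidableEq τ]

/-! ## §1 The Schur–Hadamard (coefficientwise) product -/

section Product

/-- **The Schur–Hadamard product** `f • g`: coefficientwise product (`[z^s](f • g) = [z^s]f · [z^s]g`); for
multi-affine `f = Σ a(S)z^S`, `g = Σ b(S)z^S` it is `Σ a(S)b(S)z^S`. It is the tree's diagonal operator
`z^s ↦ ([z^s]g) z^s` applied to `f`. [cite: BorceaBranden2009II, §8.2 (definition of `f • g`)] -/
def schurHadamard (f g : MvPolynomial τ ℂ) : MvPolynomial τ ℂ :=
  mvMultiplierOp (fun s => coeff s g) f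

omit [Fintype τ] [DecidableEq τ] in
/-- `[z^s](f • g) = [z^s]f · [z^s]g`. [cite: BorceaBranden2009II, §8.2 (definition of `f • g`)] -/
theorem coeff_schurHadamard (f g : MvPolynomial τ ℂ) (s : τ →₀ ℕ) :
    coeff s (schurHadamard f g) = coeff s f * coeff s g := by
  rw [schurHadamard, coeff_mvMultiplierOp, mul_comm]

omit [Fintype τ] [DecidableEq τ] in
/-- `f • g = g • f`. [cite: BorceaBranden2009II, §8.2] -/
theorem schurHadamard_comm (f g : MvPolynomial τ ℂ) : schurHadamard f g = schurHadamard g f := by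
  ext s
  rw [coeff_schurHadamard, coeff_schurHadamard, mul_comm]

end Product

/-! ## §2 Theorem 8.5 (Hinkkanen) -/

section Hinkkanen

/-- **The symbol of `T = (·) • g`**: `T[Π_i (1 + w_i z_i)](z) = g(z_1w_1,…,z_nw_n)` for multi-affine `g`.
[cite: BorceaBranden2009II, §8.2 proof of Thm. 8.5 ("`T[(1+zw)^{[n]}] = g(z_1w_1,…,z_nw_n)`")] -/
theorem eval_mvMultiplierOp_coeff_prod_one_add {g : MvPolynomial τ ℂ} (hg : IsMultiAffine g) (z w : τ → ℂ) :
    eval z (mvMultiplierOp (fun s => coeff s g) (∏ i, (1 + C (w i) * X i) ^ (fun _ : τ => 1) i)) =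
      eval (fun i => z i * w i) g := by
  have hg1 : ∀ i, degreeOf i g ≤ (fun _ : τ => 1) i := hg
  rw [apply_prod_one_add_C_mul_X_pow (fun _ : τ => 1) _ w, map_sum]
  conv_rhs => rw [eq_sum_box hg1, map_sum]
  refine sum_congr rfl fun α hα => ?_
  have hα' := mem_box_iff.1 hα
  rw [mvMultiplierOp_prod_X_pow, smul_eval, smul_eval, smul_eval, _root_.map_prod, _root_.map_prod]
  simp only [map_pow, eval_X, mul_pow]
  have hC : ∀ i, (((1 : ℕ).choose (α i) : ℕ) : ℂ) = 1 := fun i => by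
    rcases Nat.le_one_iff_eq_zero_or_eq_one.1 (hα' i) with h | h <;> simp [h]
  simp only [hC, one_mul]
  rw [prod_mul_distrib]
  ring

/-- **The `𝔻`-symbol of `T = (·) • g` is `𝔻`-stable** for `𝔻`-stable multi-affine `g`
(`|z_i w_i| < 1`). [cite: BorceaBranden2009II, §8.2 proof of Thm. 8.5 ("which is clearly `𝔻`-stable")] -/
theorem isDiskStable_boundedDegreeSymbolD_mvMultiplierOp {g : MvPolynomial τ ℂ} (hg : IsMultiAffine g)
    (hgs : IsDiskStable g) :
    IsDiskStable (boundedDegreeSymbolD (fun _ : τ => 1) (mvMultiplierOp fun s => coeff s g)) := by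
  rw [isDiskStable_boundedDegreeSymbolD_iff]
  intro z w hz hw
  rw [eval_mvMultiplierOp_coeff_prod_one_add hg]
  refine hgs _ fun i => ?_
  rw [norm_mul]
  calc ‖z i‖ * ‖w i‖ < 1 * 1 := mul_lt_mul'' (hz i) (hw i) (norm_nonneg _) (norm_nonneg _)
    _ = 1 := mul_one 1

/-- **Borcea–Brändén II, Theorem 8.5 (Hinkkanen's composition theorem).** If `f, g` are multi-affine and
`𝔻`-stable then the Schur–Hadamard product `f • g` is `𝔻`-stable unless it is identically zero. Proof as
printed: `T = (·) • g` has `𝔻`-symbol `g(z_1w_1,…,z_nw_n)`; Theorem 3.2 (`C = 𝔻`,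
`BorceaBranden_diskStabilityPreserver_iff`). [cite: BorceaBranden2009II, §8.2 Thm. 8.5 (Hinkkanen [hink])] -/
theorem hinkkanen_schurHadamard {f g : MvPolynomial τ ℂ} (hf : IsMultiAffine f) (hg : IsMultiAffine g)
    (hfs : IsDiskStable f) (hgs : IsDiskStable g) :
    IsDiskStable (schurHadamard f g) ∨ schurHadamard f g = 0 :=
  (BorceaBranden_diskStabilityPreserver_iff (fun _ : τ => 1) (mvMultiplierOp fun s => coeff s g)).2
    (Or.inr (isDiskStable_boundedDegreeSymbolD_mvMultiplierOp hg hgs)) f hf hfs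

end Hinkkanen

/-! ## §3 Theorem 8.6 (all degrees) -/

section AllDegrees

/-- **`Σ_{α ≤ κ} binom(κ,α) a(α) z^α`.** [cite: BorceaBranden2009II, §8.2 Thm. 8.6] -/
def binomWeighted (κ : τ → ℕ) (a : (τ → ℕ) → ℂ) : MvPolynomial τ ℂ :=
  ∑ α ∈ Fintype.piFinset (fun i => range (κ i + 1)),
    ((∏ i, (((κ i).choose (α i) : ℕ) : ℂ)) * a α) • ∏ i, X i ^ α i

omit [Fintype τ] [DecidableEq τ] in
/-- `𝔻`-stability descends along `rename Sum.inl` (extend a point of `𝔻^τ` by `w = 0`).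
[cite: BorceaBranden2009II, §1 (definition of `Ω`-stability)] -/
theorem isDiskStable_of_rename_inl {p : MvPolynomial τ ℂ}
    (h : IsDiskStable (rename (Sum.inl : τ → τ ⊕ τ) p)) : IsDiskStable p := by
  intro z hz
  have h2 := h (Sum.elim z fun _ => 0) fun j => by
    rcases j with i | i
    · simpa only [Sum.elim_inl] using hz i
    · simp only [Sum.elim_inr, norm_zero, zero_lt_one]
  rwa [eval_rename, Sum.elim_comp_inl] at h2

/-- `f(z) = Σ binom(κ,α) a(α) z^α`, as the `f` of Corollary 3.4 with constant `P_α = a(α)`.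
[cite: BorceaBranden2009II, §8.2 proof of Thm. 8.6] -/
theorem mvCompositionF_const (κ : τ → ℕ) (a : (τ → ℕ) → ℂ) :
    mvCompositionF κ (fun α => C (a α)) = rename Sum.inl (binomWeighted κ a) := by
  rw [mvCompositionF, binomWeighted, map_sum]
  refine sum_congr rfl fun α _ => ?_
  rw [rename_C, map_smul, _root_.map_prod, mul_smul, smul_eq_C_mul (a := a α), mul_comm (∏ i, X (Sum.inl i) ^ α i)]
  simp only [map_pow, rename_X]

/-- `g(zw) = Σ binom(κ,α) b(α) z^α w^α`, as the `g` of Corollary 3.4 with `Q_α(z) = b(α) z^α`.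
[cite: BorceaBranden2009II, §8.2 proof of Thm. 8.6 ("`g(zw)`, where `zw = (z_1w_1,…,z_nw_n)`")] -/
theorem eval_mvCompositionG_monomial (κ : τ → ℕ) (b : (τ → ℕ) → ℂ) (z w : τ → ℂ) :
    eval (Sum.elim z w) (mvCompositionG κ fun α => C (b α) * ∏ i, X i ^ α i) =
      eval (fun i => z i * w i) (binomWeighted κ b) := by
  rw [mvCompositionG, binomWeighted, map_sum, map_sum]
  refine sum_congr rfl fun α _ => ?_
  rw [smul_eval, smul_eval, _root_.map_mul, eval_rename, _root_.map_mul, eval_C, _root_.map_prod,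
    _root_.map_prod, _root_.map_prod, Sum.elim_comp_inl]
  simp only [map_pow, eval_X, Sum.elim_inr, mul_pow]
  rw [prod_mul_distrib]
  ring

/-- The polynomial of Corollary 3.4 (c) for these data is `(f • g)(z) = Σ binom(κ,α) a(α)b(α) z^α`.
[cite: BorceaBranden2009II, §8.2 proof of Thm. 8.6] -/
theorem mvCompositionD_const_monomial (κ : τ → ℕ) (a b : (τ → ℕ) → ℂ) :
    mvCompositionD κ (fun α => C (a α)) (fun α => C (b α) * ∏ i, X i ^ α i) =
      rename Sum.inl (binomWeighted κ fun α => a α * b α) := by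
  rw [mvCompositionD, binomWeighted, map_sum]
  refine sum_congr rfl fun α _ => ?_
  rw [rename_C, _root_.map_mul, rename_C, map_smul, _root_.map_prod, mul_smul, smul_eq_C_mul (a := a α * b α),
    _root_.map_mul]
  simp only [map_pow, rename_X]
  ring

/-- **Borcea–Brändén II, Theorem 8.6.** If `f = Σ_{α≤κ} binom(κ,α) a(α) z^α` and `g = Σ_{α≤κ} binom(κ,α) b(α) z^α`
are `𝔻`-stable, then `f • g = Σ_{α≤κ} binom(κ,α) a(α) b(α) z^α` is `𝔻`-stable unless it is identically zero.
Proof as printed: Corollary 3.4 (c) (`mv_master_composition_disk`) applied to `f(z)` and `g(zw)`.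
[cite: BorceaBranden2009II, §8.2 Thm. 8.6] -/
theorem schurHadamard_binomWeighted_diskStable (κ : τ → ℕ) (a b : (τ → ℕ) → ℂ)
    (hf : IsDiskStable (binomWeighted κ a)) (hg : IsDiskStable (binomWeighted κ b)) :
    binomWeighted κ (fun α => a α * b α) = 0 ∨ IsDiskStable (binomWeighted κ fun α => a α * b α) := by
  have hF : IsDiskStable (mvCompositionF κ fun α => C (a α)) := by
    rw [mvCompositionF_const]
    exact hf.rename Sum.inl
  have hG : IsDiskStable (mvCompositionG κ fun α => C (b α) * ∏ i, X i ^ α i) := by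
    intro zw hzw
    rw [← Sum.elim_comp_inl_inr zw, eval_mvCompositionG_monomial]
    refine hg _ fun i => ?_
    rw [norm_mul]
    calc ‖zw (Sum.inl i)‖ * ‖zw (Sum.inr i)‖ < 1 * 1 :=
        mul_lt_mul'' (hzw _) (hzw _) (norm_nonneg _) (norm_nonneg _)
      _ = 1 := mul_one 1
  rcases mv_master_composition_disk _ _ hF hG with h | h
  · left
    rw [mvCompositionD_const_monomial] at h
    exact rename_injective _ Sum.inl_injective (by rw [h, map_zero])
  · right
    rw [mvCompositionD_const_monomial] at h
    exact isDiskStable_of_rename_inl h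

end AllDegrees

end Literature.Combinatorics.StablePolynomials

end
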